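import Mathlib
import Literature.Analysis.FluidPDE.BarkerPrangeLocalizedSmoothingBounds
import Literature.Analysis.FluidPDE.BarkerPrangeConcentrationProofs
import Literature.Analysis.FluidPDE.NSSereginEnergyApproximants
import Literature.Analysis.FluidPDE.SuitableWeakProofs
import Literature.Analysis.FluidPDE.ClassicalSuitable
import Literature.Analysis.FluidPDE.SpaceTimeCalculusC1
import Literature.Analysis.FluidPDE.TaoEnstrophyLocalisationProofs
import Literature.Analysis.FluidPDE.CKNInterpolationEstimate
import Literature.Analysis.FluidPDE.AncientWeakL3BackwardLiouvilleAssembly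
import Literature.Analysis.FluidPDE.LocalLerayExistence
import HarnessLib

/-!
# Shelf crux `EnstrophyQuarterLaw` (stmt-NavierStokesRegularity-1574), line «sparse_sieve»:
# the localized-smoothing GRADIENT ENVELOPE for a classical solution (towards `stub_smoothingEnvelope`)

Theorems helper file (seat ns-hhe-c1 g2; `--supports` the shelf crux). The analytic heart of the
registered stub `stub_smoothingEnvelope` (S3, KNOWN) of
`Cruxes/EnstrophyQuarterLaw/Lines/sparse_sieve.lean`: Barker–Prange 2020, Thm 1 in the tree's
quantitative slab form (`BarkerPrange2020_thm1_slab_bounds`, p607305: gradient envelope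
`|∇v| ≤ C₁` a.e. on `(β, S) × B_{1/3}` for local energy solutions with unit viscosity and
locally critical datum) transported to a classical Leray–Hopf solution `u` on `[0, T)` with
viscosity `ν`, RESTARTED at an interior time `t₀ ∈ (0, T)` and RESCALED to scale `R` and centre
`x₀` (`v(s, y) = (R/ν) u(t₀ + R² s/ν, x₀ + R y)`, the tree's
`IsLerayHopfOn.exists_isLocalEnergySolutionOn_rescaled_restart`, interior regularity
`IsClassicalNSSolutionOn.isRegularPoint_holds`):

* `gradient_envelope_core` — for `ν, T, M > 0` there are `γ, σ, C₁ > 0` (namely `γ = ν γ₀`,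
  `σ = S(√M/ν)/ν`, `C₁ = C₁(√M/ν, S/2)` from Barker–Prange) such that for every interior restart
  time `t₀ > 0`, scale `R > 0` with `t₀ + σ R² ≤ T`, uniform local energy
  `∫_{B(x₁,R)} |u(t₀)|² ≤ M R` (all `x₁`) and smallness `∫_{B(x₀,2R)} |u(t₀)|³ ≤ γ³`, the
  classical gradient obeys `‖D u(t)(y)‖ ≤ C₁ ν / R²` for all `t ∈ (t₀ + σR²/2, t₀ + σR²)`,
  `y ∈ B(x₀, R/3)` (the a.e. bound of the zoom is an everywhere bound by continuity,
  `norm_le_of_ae_le_of_continuousOn`; `‖L‖ ≤ |L|_F`);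
* small conversions `eLpNorm_two_le_of_lintegral_sq_le`, `eLpNorm_three_le_of_lintegral_cube_le`.

HONEST FRAMING: an a-priori estimate for a GIVEN classical solution (no blow-up asserted, no
summit statement proved); the boundary restart time `t₀ = 0` of the registered stub is treated in
the next file.

References: T. Barker, C. Prange, ARMA 236 (2020) = arXiv:1812.09115, Thm 1; K. Kang, H. Miura,
T.-P. Tsai, IMRN 2021 = arXiv:1812.10509, Thm 1.1; G. Seregin, CMP 312 (2012), §2 (2.3) (the
rescaled restart).
-/

noncomputable section

-- the summit and its single sub-problem share the name (CONVENTIONS §1), as in every Theorems file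
set_option linter.dupNamespace false

namespace Summit.NavierStokesRegularity.NavierStokesRegularity.Theorems.EnstrophyQuarterLaw.SparseSieve

open MeasureTheory Set Metric Filter Topology Function
open Literature.Analysis Literature.Analysis.FluidPDE
open scoped ENNReal NNReal

/-! ### `L^p` norms from `lintegral` bounds -/

/-- `∫ ‖f‖² ≤ A` gives `‖f‖_{L²} ≤ √A`. [folklore] -/
theorem eLpNorm_two_le_of_lintegral_sq_le {α F : Type*} [MeasurableSpace α] {μ : Measure α}
    [NormedAddCommGroup F] {f : α → F} {A : ℝ} (hA : 0 ≤ A)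
    (h : ∫⁻ x, ‖f x‖ₑ ^ 2 ∂μ ≤ ENNReal.ofReal A) :
    eLpNorm f 2 μ ≤ ENNReal.ofReal (Real.sqrt A) := by
  rw [eLpNorm_eq_lintegral_rpow_enorm_toReal two_ne_zero ENNReal.ofNat_ne_top, ENNReal.toReal_ofNat]
  have e : ∫⁻ x, ‖f x‖ₑ ^ (2 : ℝ) ∂μ = ∫⁻ x, ‖f x‖ₑ ^ 2 ∂μ :=
    lintegral_congr fun x => by rw [show (2 : ℝ) = ((2 : ℕ) : ℝ) by norm_num, ENNReal.rpow_natCast]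
  rw [e]
  calc (∫⁻ x, ‖f x‖ₑ ^ 2 ∂μ) ^ (1 / (2 : ℝ)) ≤ (ENNReal.ofReal A) ^ (1 / (2 : ℝ)) :=
        ENNReal.rpow_le_rpow h (by norm_num)
    _ = ENNReal.ofReal (A ^ (1 / (2 : ℝ))) := ENNReal.ofReal_rpow_of_nonneg hA (by norm_num)
    _ = ENNReal.ofReal (Real.sqrt A) := by rw [Real.sqrt_eq_rpow]

/-- `∫ ‖f‖³ ≤ B³` (`B ≥ 0`) gives `‖f‖_{L³} ≤ B`. [folklore] -/
theorem eLpNorm_three_le_of_lintegral_cube_le {α F : Type*} [MeasurableSpace α] {μ : Measure α}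
    [NormedAddCommGroup F] {f : α → F} {B : ℝ} (hB : 0 ≤ B)
    (h : ∫⁻ x, ‖f x‖ₑ ^ 3 ∂μ ≤ ENNReal.ofReal (B ^ 3)) :
    eLpNorm f 3 μ ≤ ENNReal.ofReal B := by
  rw [eLpNorm_eq_lintegral_rpow_enorm_toReal three_ne_zero ENNReal.ofNat_ne_top, ENNReal.toReal_ofNat]
  have e : ∫⁻ x, ‖f x‖ₑ ^ (3 : ℝ) ∂μ = ∫⁻ x, ‖f x‖ₑ ^ 3 ∂μ :=
    lintegral_congr fun x => by rw [show (3 : ℝ) = ((3 : ℕ) : ℝ) by norm_num, ENNReal.rpow_natCast]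
  rw [e]
  calc (∫⁻ x, ‖f x‖ₑ ^ 3 ∂μ) ^ (1 / (3 : ℝ)) ≤ (ENNReal.ofReal (B ^ 3)) ^ (1 / (3 : ℝ)) :=
        ENNReal.rpow_le_rpow h (by norm_num)
    _ = ENNReal.ofReal ((B ^ 3) ^ (1 / (3 : ℝ))) := ENNReal.ofReal_rpow_of_nonneg (by positivity) (by norm_num)
    _ = ENNReal.ofReal B := by
        rw [← Real.rpow_natCast B 3, ← Real.rpow_mul hB]; norm_num

/-! ### The gradient envelope after an interior restart -/

/-- **Gradient envelope of a classical solution by localized smoothing** (Barker–Prange 2020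
Thm 1 / Kang–Miura–Tsai 2021 Thm 1.1, quantitative, rescaled, restarted). For `ν, T > 0`, a
classical solution `(u, p)` on `[0, T)` which is Leray–Hopf on `[0, T]` from `u 0`, and `M > 0`,
there are `γ, σ, C₁ > 0` such that: whenever `0 < t₀`, `0 < R`, `t₀ + σ R² ≤ T`,
`∫_{B(x₁, R)} |u(t₀)|² ≤ M R` for every centre `x₁`, and `∫_{B(x₀, 2R)} |u(t₀)|³ ≤ γ³`, then
`‖D(u t)(y)‖ ≤ C₁ ν / R²` for all `t ∈ (t₀ + σR²/2, t₀ + σR²)` and `y ∈ B(x₀, R/3)`.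
Proof: the rescaled restart `v(s,y) = (R/ν) u(t₀ + R²s/ν, x₀ + Ry)` is a local energy solution
with unit viscosity on `(0, S)`, `S = νσ` (`exists_isLocalEnergySolutionOn_rescaled_restart`), its
datum is in `E²` with `‖v₀‖_{L²(B₁(x̄))} ≤ √M/ν` and `‖v₀‖_{L³(B₂)} ≤ γ/ν = γ₀`; Barker–Prange's
slab bound gives `|∇v|_F ≤ C₁` a.e. on `(S/2, S) × B_{1/3}`, everywhere by continuity, and
`∇v(s, y) = (R²/ν) ∇u(t₀ + R²s/ν, x₀ + Ry)`. [cite: BarkerPrange2020, Thm 1 (arXiv:1812.09115 p. 2)] -/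
theorem gradient_envelope_core {ν T : ℝ} (hν : 0 < ν) (hT : 0 < T)
    {u : ℝ → EuclideanSpace ℝ (Fin 3) → EuclideanSpace ℝ (Fin 3)}
    {p : ℝ → EuclideanSpace ℝ (Fin 3) → ℝ}
    (hcl : IsClassicalNSSolutionOn (Ico 0 T) ν 0 u p) (hLH : IsLerayHopfOn T ν 0 (u 0) u)
    {M : ℝ} (hM : 0 < M) :
    ∃ γ σ C₁ : ℝ, 0 < γ ∧ 0 < σ ∧ 0 < C₁ ∧
      ∀ (t₀ R : ℝ) (x₀ : EuclideanSpace ℝ (Fin 3)), 0 < t₀ → 0 < R → t₀ + σ * R ^ 2 ≤ T →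
        (∀ x₁ : EuclideanSpace ℝ (Fin 3),
          ∫⁻ y in ball x₁ R, ‖u t₀ y‖ₑ ^ 2 ≤ ENNReal.ofReal (M * R)) →
        ∫⁻ y in ball x₀ (2 * R), ‖u t₀ y‖ₑ ^ 3 ≤ ENNReal.ofReal (γ ^ 3) →
        ∀ t ∈ Ioo (t₀ + σ * R ^ 2 / 2) (t₀ + σ * R ^ 2), ∀ y ∈ ball x₀ (R / 3),
          ‖fderiv ℝ (u t) y‖ ≤ C₁ * ν / R ^ 2 := by
  obtain ⟨γ₀, hγ₀, HBP⟩ := BarkerPrange2020_thm1_slab_bounds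
  set M' : ℝ := Real.sqrt M / ν with hM'def
  have hM' : 0 < M' := by positivity
  obtain ⟨S, hS, hS4, HS⟩ := HBP M' hM'
  obtain ⟨C, C₁, hC, hC₁, HB⟩ := HS (S / 2) ⟨by linarith, by linarith⟩
  refine ⟨ν * γ₀, S / ν, C₁, by positivity, by positivity, hC₁, ?_⟩
  intro t₀ R x₀ ht₀ hR hfit hL2 hL3 t ht y hy
  have hν0 : ν ≠ 0 := hν.ne'
  have hR0 : R ≠ 0 := hR.ne'
  have hσR : 0 < S / ν * R ^ 2 := by positivity
  have ht₀T : t₀ < T := by linarith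
  -- regular points of the classical solution on the open strip
  have hreg : ∀ s ∈ Ioo 0 T, ∀ z : EuclideanSpace ℝ (Fin 3), IsRegularPoint u (s, z) :=
    fun s hs z => IsClassicalNSSolutionOn.isRegularPoint_holds hcl (by rw [interior_Ico]; exact hs) z
  -- the rescaled restart, a local energy solution with unit viscosity on `(0, ν (T - t₀) / R²) ⊇ (0, S)`
  obtain ⟨π, hv⟩ := hLH.exists_isLocalEnergySolutionOn_rescaled_restart hν hT hreg ⟨ht₀, ht₀T⟩ hR x₀
  have hSle : S ≤ ν * (T - t₀) / R ^ 2 := by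
    rw [le_div_iff₀ (by positivity)]
    have h1 : S / ν * R ^ 2 ≤ T - t₀ := by linarith
    have h2 := mul_le_mul_of_nonneg_left h1 hν.le
    have e : ν * (S / ν * R ^ 2) = S * R ^ 2 := by field_simp
    linarith [e ▸ h2]
  have hvS := hv.mono hSle
  -- the datum: in `E²`, with the two bounds of Barker–Prange
  have hut : MemLp (u t₀) 2 volume := hLH.memLp t₀ ⟨ht₀.le, ht₀T.le⟩
  have hv₀2 : MemLp (fun y => (R / ν) • u t₀ (x₀ + R • y)) 2 volume :=
    (memLp_comp_add_smul hut x₀ hR).const_smul (R / ν)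
  have hE2 : MemE2 (fun y => (R / ν) • u t₀ (x₀ + R • y)) := memE2_of_memLp hv₀2 le_rfl (by norm_num)
  have hsmul : ∀ q : ℝ≥0∞, ∀ μ : Measure (EuclideanSpace ℝ (Fin 3)),
      eLpNorm (fun y => (R / ν) • u t₀ (x₀ + R • y)) q μ =
        ‖R / ν‖ₑ * eLpNorm (fun y => u t₀ (x₀ + R • y)) q μ := fun q μ => by
    rw [show (fun y => (R / ν) • u t₀ (x₀ + R • y)) = (R / ν) • fun y => u t₀ (x₀ + R • y)
      from rfl, eLpNorm_const_smul]
  have hlν : ‖R / ν‖ₑ = ENNReal.ofReal (R / ν) := Real.enorm_eq_ofReal (by positivity)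
  have hsR : Real.sqrt R ^ 2 = R := Real.sq_sqrt hR.le
  have hs0 : 0 < Real.sqrt R := Real.sqrt_pos.2 hR
  have hL2' : ∀ x₁ : EuclideanSpace ℝ (Fin 3),
      eLpNorm (fun y => (R / ν) • u t₀ (x₀ + R • y)) 2 (volume.restrict (ball x₁ 1)) ≤
        ENNReal.ofReal M' := by
    intro x₁
    have h1 : eLpNorm (u t₀) 2 (volume.restrict (ball (x₀ + R • x₁) (R * 1))) ≤
        ENNReal.ofReal (Real.sqrt (M * R)) := by
      rw [mul_one]
      exact eLpNorm_two_le_of_lintegral_sq_le (by positivity) (hL2 _)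
    calc eLpNorm (fun y => (R / ν) • u t₀ (x₀ + R • y)) 2 (volume.restrict (ball x₁ 1))
        = ‖R / ν‖ₑ * (ENNReal.ofReal ((R ^ 3)⁻¹) ^ (1 / (2 : ℝ≥0∞)).toReal *
            eLpNorm (u t₀) 2 (volume.restrict (ball (x₀ + R • x₁) (R * 1)))) := by
          rw [hsmul, eLpNorm_comp_add_smul_ball (u t₀) x₀ x₁ hR 1 (by norm_num)]
      _ ≤ ‖R / ν‖ₑ * (ENNReal.ofReal ((Real.sqrt R ^ 3)⁻¹) *
            ENNReal.ofReal (Real.sqrt (M * R))) := by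
          rw [ofReal_inv_cube_rpow_half hR]
          gcongr
      _ = ENNReal.ofReal M' := by
          rw [hlν, ← ENNReal.ofReal_mul (by positivity), ← ENNReal.ofReal_mul (by positivity),
            Real.sqrt_mul hM.le, hM'def]
          congr 1
          rw [pow_succ, hsR]
          field_simp
  have hL3' : eLpNorm (fun y => (R / ν) • u t₀ (x₀ + R • y)) 3
      (volume.restrict (ball (0 : EuclideanSpace ℝ (Fin 3)) 2)) ≤ ENNReal.ofReal γ₀ := by
    have h1 : eLpNorm (u t₀) 3 (volume.restrict (ball x₀ (2 * R))) ≤ ENNReal.ofReal (ν * γ₀) :=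
      eLpNorm_three_le_of_lintegral_cube_le (by positivity) hL3
    calc eLpNorm (fun y => (R / ν) • u t₀ (x₀ + R • y)) 3
          (volume.restrict (ball (0 : EuclideanSpace ℝ (Fin 3)) 2))
        = ‖R / ν‖ₑ * (ENNReal.ofReal ((R ^ 3)⁻¹) ^ (1 / (3 : ℝ≥0∞)).toReal *
            eLpNorm (u t₀) 3 (volume.restrict (ball (x₀ + R • (0 : EuclideanSpace ℝ (Fin 3)))
              (R * 2)))) := by
          rw [hsmul, eLpNorm_comp_add_smul_ball (u t₀) x₀ 0 hR 2 (by norm_num)]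
      _ ≤ ‖R / ν‖ₑ * (ENNReal.ofReal R⁻¹ * ENNReal.ofReal (ν * γ₀)) := by
          rw [ofReal_inv_cube_rpow_third hR, smul_zero, add_zero, mul_comm R 2]
          gcongr
      _ = ENNReal.ofReal γ₀ := by
          rw [hlν, ← ENNReal.ofReal_mul (by positivity), ← ENNReal.ofReal_mul (by positivity)]
          congr 1
          field_simp
  -- Barker–Prange on the zoom: the gradient conjunct
  obtain ⟨-, -, hgrad⟩ := HB _ _ π hvS hE2 hL2' hL3'
  -- the zoom is smooth on the open strip; its classical gradient is a weak gradient
  set v : ℝ → EuclideanSpace ℝ (Fin 3) → EuclideanSpace ℝ (Fin 3) :=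
    fun s z => (R / ν) • u (t₀ + R ^ 2 / ν * s) (x₀ + R • z) with hvdef
  set A : ℝ × EuclideanSpace ℝ (Fin 3) → ℝ × EuclideanSpace ℝ (Fin 3) :=
    fun q => (t₀ + R ^ 2 / ν * q.1, x₀ + R • q.2) with hAdef
  have hAff : ContDiff ℝ 1 A :=
    (contDiff_const.add (contDiff_const.mul contDiff_fst)).prodMk
      (contDiff_const.add (contDiff_snd.const_smul R))
  have hmaps : MapsTo A (Ioo 0 S ×ˢ univ) (Ico 0 T ×ˢ univ) := by
    intro q hq
    have hq1 : q.1 ∈ Ioo 0 S := hq.1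
    refine ⟨⟨?_, ?_⟩, mem_univ _⟩
    · show 0 ≤ t₀ + R ^ 2 / ν * q.1
      have : 0 ≤ R ^ 2 / ν * q.1 := mul_nonneg (by positivity) hq1.1.le
      linarith
    · show t₀ + R ^ 2 / ν * q.1 < T
      have h1 : R ^ 2 / ν * q.1 < R ^ 2 / ν * S := mul_lt_mul_of_pos_left hq1.2 (by positivity)
      have e : R ^ 2 / ν * S = S / ν * R ^ 2 := by ring
      linarith
  have hu1 : ContDiffOn ℝ 1 (uncurry u) (Ico 0 T ×ˢ univ) := hcl.smooth_velocity.of_le (by norm_cast)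
  have hv1 : ContDiffOn ℝ 1 (uncurry v) (Ioo 0 S ×ˢ univ) := by
    have e : uncurry v = fun q => (R / ν) • (uncurry u ∘ A) q := by
      funext q; rfl
    rw [e]
    exact (hu1.comp hAff.contDiffOn hmaps).const_smul (R / ν)
  have hGw : HasWeakSpatialGradientOn (slab (EuclideanSpace ℝ (Fin 3)) (Ioo 0 S) isOpen_Ioo) v
      (fun s z => fderiv ℝ (v s) z) :=
    hasWeakSpatialGradientOn_of_contDiffOn isOpen_Ioo (fun _ h => h) hv1
  have hae := hgrad _ hGw
  -- everywhere on the open box, by continuity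
  have hGc : ContinuousOn (fun w : ℝ × EuclideanSpace ℝ (Fin 3) => fderiv ℝ (v w.1) w.2)
      (Ioo 0 S ×ˢ univ) := continuousOn_fderiv_slice_of_contDiffOn hv1 (uniqueDiffOn_Ioo 0 S)
  have hFc : ContinuousOn (fun w : ℝ × EuclideanSpace ℝ (Fin 3) =>
      Real.sqrt (frobeniusNormSq (fderiv ℝ (v w.1) w.2)))
      (Ioo (S / 2) S ×ˢ ball (0 : EuclideanSpace ℝ (Fin 3)) (1 / 3)) :=
    ((Real.continuous_sqrt.comp continuous_frobeniusNormSq').comp_continuousOn hGc).mono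
      (prod_mono (Ioo_subset_Ioo_left (by linarith)) (subset_univ _))
  have hall := norm_le_of_ae_le_of_continuousOn (isOpen_Ioo.prod isOpen_ball) hFc (K := C₁)
    (hae.mono fun w hw => by rw [Real.norm_of_nonneg (Real.sqrt_nonneg _)]; exact hw)
  -- the point `(s, y')` of the zoom over `(t, y)`
  set s : ℝ := ν * (t - t₀) / R ^ 2 with hsdef
  set y' : EuclideanSpace ℝ (Fin 3) := R⁻¹ • (y - x₀) with hy'def
  have hts : t₀ + R ^ 2 / ν * s = t := by rw [hsdef]; field_simp; ring
  have hyy : x₀ + R • y' = y := by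
    rw [hy'def, smul_smul, mul_inv_cancel₀ hR0, one_smul, add_sub_cancel]
  have hsI : s ∈ Ioo (S / 2) S := by
    have h1 : S / ν * R ^ 2 / 2 < t - t₀ := by linarith [ht.1]
    have h2 : t - t₀ < S / ν * R ^ 2 := by linarith [ht.2]
    constructor
    · rw [hsdef, lt_div_iff₀ (by positivity)]
      have := mul_lt_mul_of_pos_left h1 hν
      have e : ν * (S / ν * R ^ 2 / 2) = S / 2 * R ^ 2 := by field_simp
      linarith
    · rw [hsdef, div_lt_iff₀ (by positivity)]
      have := mul_lt_mul_of_pos_left h2 hν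
      have e : ν * (S / ν * R ^ 2) = S * R ^ 2 := by field_simp
      linarith
  have hy'I : y' ∈ ball (0 : EuclideanSpace ℝ (Fin 3)) (1 / 3) := by
    rw [mem_ball_zero_iff, hy'def, norm_smul, Real.norm_eq_abs, abs_inv, abs_of_pos hR]
    have h1 : ‖y - x₀‖ < R / 3 := by rwa [mem_ball, dist_eq_norm] at hy
    rw [inv_mul_lt_iff₀ hR]
    linarith
  have hb := hall (s, y') ⟨hsI, hy'I⟩
  -- chain rule: `D(v s)(y') = (R²/ν) D(u t)(y)`
  have htI : t ∈ Ico 0 T := ⟨by linarith [ht.1], by linarith [ht.2]⟩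
  have hdiff : DifferentiableAt ℝ (u t) y :=
    ((hcl.contDiff_velocity htI).differentiable (by simp)).differentiableAt
  have hchain : HasFDerivAt (v s)
      ((R / ν) • (fderiv ℝ (u t) y).comp (R • ContinuousLinearMap.id ℝ (EuclideanSpace ℝ (Fin 3)))) y' := by
    have h1 : HasFDerivAt (fun z : EuclideanSpace ℝ (Fin 3) => x₀ + R • z)
        (R • ContinuousLinearMap.id ℝ (EuclideanSpace ℝ (Fin 3))) y' :=
      ((hasFDerivAt_id y').const_smul R).const_add x₀
    have h2 : HasFDerivAt (u t) (fderiv ℝ (u t) y) (x₀ + R • y') := by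
      rw [hyy]; exact hdiff.hasFDerivAt
    have h3 := (h2.comp y' h1).const_smul (R / ν)
    have e : v s = fun z => (R / ν) • ((u t) ∘ fun z : EuclideanSpace ℝ (Fin 3) => x₀ + R • z) z := by
      funext z
      show (R / ν) • u (t₀ + R ^ 2 / ν * s) (x₀ + R • z) = _
      rw [hts]; rfl
    rw [e]; exact h3
  have hfd : fderiv ℝ (v s) y' = (R ^ 2 / ν) • fderiv ℝ (u t) y := by
    rw [hchain.fderiv, ContinuousLinearMap.comp_smul, ContinuousLinearMap.comp_id, smul_smul]
    congr 1; ring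
  have hop : ‖fderiv ℝ (v s) y'‖ ≤ C₁ := by
    have h1 : ‖fderiv ℝ (v s) y'‖ ≤ Real.sqrt (frobeniusNormSq (fderiv ℝ (v s) y')) := by
      rw [← Real.sqrt_sq (norm_nonneg (fderiv ℝ (v s) y'))]
      exact Real.sqrt_le_sqrt (sq_opNorm_le_frobeniusNormSq _)
    have h2 : Real.sqrt (frobeniusNormSq (fderiv ℝ (v s) y')) ≤ C₁ := by
      have := hb
      rwa [Real.norm_of_nonneg (Real.sqrt_nonneg _)] at this
    exact h1.trans h2
  rw [hfd, norm_smul, Real.norm_of_nonneg (by positivity)] at hop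
  rw [le_div_iff₀ (by positivity)]
  have h3 := mul_le_mul_of_nonneg_right hop hν.le
  have e : R ^ 2 / ν * ‖fderiv ℝ (u t) y‖ * ν = ‖fderiv ℝ (u t) y‖ * R ^ 2 := by
    field_simp
  linarith [e ▸ h3]

end Summit.NavierStokesRegularity.NavierStokesRegularity.Theorems.EnstrophyQuarterLaw.SparseSieve

end
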